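import Literature.AlgebraicGeometry.AbelianSchemes.AbelianVarietyCechDiagonalMaps
import Literature.AlgebraicGeometry.AbelianSchemes.AbelianVarietyCechCupSurjective
import HarnessLib

/-!
# `[2]^* = 2` on `Ȟ¹(A, 𝒪)` and `[2]^* = 4` on `Ȟ²(A, 𝒪)` for an abelian variety, read on the diagonal Čech cover (Mumford AV §13 Cor. 2)

Layer `Literature/AlgebraicGeometry/AbelianSchemes`; namespace `Literature.AlgebraicGeometry.AbelianSchemes.AbelianVarietyCech`.  PROOF file
(theorems only).  Cell `hodgecm-mathlib` FLOOR 0, F-11 sub-line P1b, MONO-G1 slot (5) `hrel₃` road (R109) piece **N1b** (F0P1b-p01 (g2));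
consumer N4 `AbelianVarietyCechH2MulTwoRaw` (F0P1b-p04 (g2)): the module-Čech letter `[ref_{τ′} comap_{[2]} z] = 4 • [ref_τ z]` of the
abelian obstruction socket.  Over ★ `AbelianVarietyCechDiagonalMaps` (N1a: the diagonal cover `WΔ`, the maps `twoΔ = [2]^*`, `refΔ₁ = ref`,
`ΔT = Δ^*`, the composites `Δ^* m_T^* = [2]^*`, `Δ^* r^* pᵢ^* = refᵢ`, `ref₁ = ref₂`, multiplicativity) and ★ `AbelianVarietyCechProductComposites` ∕
`AbelianVarietyCechCupSurjective` (F0P1b-p02 (g2): the slice composites, the Künneth surjectivity `hsurj`, the units, and HEAD 1 `Ȟ¹ ⊗ Ȟ¹ ↠ Ȟ²`):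

* **`mS_degree_one : m^* a = p₁^* a + p₂^* a`** for `a ∈ Ȟ¹(U, 𝒪_A)` (★ `coproduct_degree_one` on these instances);
* **`twoΔ_degree_one : [2]^* a = 2 • ref a`** in `Ȟ¹(WΔ)` (`[2]^* = Δ^* r^* m^*`, primitivity, `Δ^* r^* pᵢ^* = refᵢ`, `ref₁ = ref₂`);
* **`twoΔ_degree_two_of_covers : [2]^* x = (2·2) • ref x`** in `Ȟ²(WΔ)` (HEAD 1 + multiplicativity of `[2]^*` and `ref`);
* heads **`homologyMap_mulTwo_degree_one`**, **`homologyMap_mulTwo_degree_two`** with only `A`, `U`, `hcov`, `WΔ`, `hWΔ` as binders.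

## References
* [MumfordAV1970] D. Mumford, *Abelian Varieties* (1970), §13 Cor. 2 (p. 129): `n_X^*` acts on `H^p(X, 𝒪_X)` as `n^p`; proof via
  `m^* = p₁^* + p₂^*` on `H¹` and the ring structure.
* [MilnorMoore1965] J. Milnor, J. Moore, *On the structure of Hopf algebras*, Ann. Math. 81 (1965), §4 Prop. 4.17 (p. 231).
* [StacksProject] The Stacks Project, Tag 01FP.
-/

noncomputable section

open CategoryTheory CategoryTheory.Limits CategoryTheory.MonoidalCategory AlgebraicGeometry TopologicalSpace Opposite
open HomologicalComplex TensorProduct Finset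
open Literature.Algebra.Homology Literature.Algebra.Homology.OrderedCech Literature.AlgebraicGeometry.Modules
open Literature.AlgebraicGeometry.Morphisms

set_option backward.isDefEq.respectTransparency false

namespace Literature.AlgebraicGeometry.AbelianSchemes.AbelianVarietyCech

universe u

section MulTwo

variable {k : Type} [Field k] [CharZero k] (A : AbelianSchemeOver (Spec (.of k)))
  {ι : Type} [LinearOrder ι] [Fintype ι] (U : ι → A.X.left.affineOpens) (hcov : ⨆ i, (U i).1 = ⊤)
  (W₀ : ι ×ₗ ι → (X2 A).affineOpens)
  (hW₀ : ∀ i j, (W₀ (toLex (i, j))).1 = p₁ A ⁻¹ᵁ (U i).1 ⊓ p₂ A ⁻¹ᵁ (U j).1)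
  (W : (ι ×ₗ ι) ×ₗ ι → (X2 A).affineOpens)
  (hW : ∀ c l, (W (toLex (c, l))).1 = (W₀ c).1 ⊓ m A ⁻¹ᵁ (U l).1)
  (j₀ : ι) (hj₀ : e A ⁻¹ᵁ (U j₀).1 = ⊤)
  (WΔ : (ι ×ₗ ι) ×ₗ ι → A.X.left.affineOpens)
  (hWΔ : ∀ i j l, (WΔ (toLex (toLex (i, j), l))).1 = (U i).1 ⊓ (U j).1 ⊓ mulTwo A ⁻¹ᵁ (U l).1)

/-! ### Degree one: primitivity and `[2]^* a = 2 • ref₁ a` -/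

omit [CharZero k] in
include hcov hW₀ hW hj₀ in
/-- **Degree-one classes are primitive**: `m^* a = p₁^* a + p₂^* a` for `a ∈ Ȟ¹(U, 𝒪_A)` (★ J3 `coproduct_degree_one` on the
instances of this file). [cite: MumfordAV1970, §13 Cor. 2 (p. 129)] -/
theorem mS_degree_one (a : (CA A U).homology ((1 : ℕ) : ℤ)) :
    mS A U hcov W₀ hW₀ W hW 1 a = pOne A U W₀ hW₀ 1 a + pTwo A U W₀ hW₀ 1 a := by
  classical
  have hρ₁ : Function.Bijective (ρ₁ A) :=
    (A.app_bijective_of_isArtinianRing ⊤).comp (Scheme.ΓSpecIso (.of k)).commRingCatIsoToRingEquiv.symm.bijective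
  obtain ⟨eA, heA⟩ := exists_unitCycle (U' A U) (ρ₁ A)
  obtain ⟨eS, heS⟩ := exists_unitCycle (W₀' A W₀) (ρ₂ A)
  obtain ⟨aug, haug⟩ := exists_augmentation (U' A U) (ρ₁ A) hcov hρ₁ eA heA
  haveI : Fintype (ι ×ₗ ι) := inferInstanceAs (Fintype (ι × ι))
  exact Literature.Algebra.Bialgebra.coproduct_degree_one (k := k)
    (HA := fun n => (CA A U).homology (n : ℤ)) (HS := fun n => (CS A W₀).homology (n : ℤ))
    (cupS := cupS A W₀) (m := mS A U hcov W₀ hW₀ W hW) (p₁ := pOne A U W₀ hW₀)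
    (p₂ := pTwo A U W₀ hW₀) (i₁ := iOne A U W₀ hW₀ j₀ hj₀) (i₂ := iTwo A U W₀ hW₀ j₀ hj₀)
    (oneA := ((CA A U).homologyπ _).hom eA) (oneS := ((CS A W₀).homologyπ _).hom eS) (aug := aug)
    (haug := haug)
    (hp₁_one := pOne_one A U W₀ hW₀ eA eS heA heS) (hp₂_one := pTwo_one A U W₀ hW₀ eA eS heA heS)
    (honeS_left := fun b y =>
      cupH_unit_left _ (unitFamily _ _) (unitFamily_compatible _ _) (mulPairing_unitFamily_left _ _) eS heS b y)
    (honeS_right := fun a y =>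
      cupH_unit_right _ (unitFamily _ _) (unitFamily_compatible _ _) (mulPairing_unitFamily_right _ _) eS heS a y)
    (hi₁m := hi₁m A U hcov W₀ hW₀ W hW j₀ hj₀) (hi₂m := hi₂m A U hcov W₀ hW₀ W hW j₀ hj₀)
    (hi₁p₁ := hi₁p₁ A U W₀ hW₀ j₀ hj₀) (hi₂p₂ := hi₂p₂ A U W₀ hW₀ j₀ hj₀)
    (hi₁p₂ := hi₁p₂ A U W₀ hW₀ j₀ hj₀) (hi₂p₁ := hi₂p₁ A U W₀ hW₀ j₀ hj₀)
    (hsurj := hsurj A U hcov W₀ hW₀) a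

omit [CharZero k] in
include hcov hW₀ hW hj₀ in
/-- **`[2]^* a = 2 • ref a` on `Ȟ¹(U, 𝒪_A)`**, read on the diagonal cover. [cite: MumfordAV1970, §13 Cor. 2] -/
theorem twoΔ_degree_one (a : (CA A U).homology ((1 : ℕ) : ℤ)) :
    twoΔ A U WΔ hWΔ 1 a = (2 : k) • refΔ₁ A U WΔ hWΔ 1 a := by
  have hr : rT A U W₀ W hW 1 (mS A U hcov W₀ hW₀ W hW 1 a) = mT A U W₀ W hW 1 a :=
    (LinearEquiv.ofBijective (rT A U W₀ W hW 1) (rT_bijective A U hcov W₀ hW₀ W hW 1)).apply_symm_apply _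
  rw [← ΔT_mT A U W₀ hW₀ W hW WΔ hWΔ, ← hr, mS_degree_one A U hcov W₀ hW₀ W hW j₀ hj₀, map_add, map_add,
    ΔT_rT_pOne A U W₀ hW₀ W hW WΔ hWΔ, ΔT_rT_pTwo A U W₀ hW₀ W hW WΔ hWΔ, ← refΔ₁_eq_refΔ₂ A U WΔ hWΔ, two_smul]

/-! ### Degree two: `[2]^* x = 4 • ref₁ x` -/

include hcov hW₀ hW hj₀ in
/-- **`[2]^* x = 4 • ref x` on `Ȟ²(U, 𝒪_A)`**, read on the diagonal cover (with the covers as binders).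
[cite: MumfordAV1970, §13 Cor. 2] -/
theorem twoΔ_degree_two_of_covers (x : (CA A U).homology ((2 : ℕ) : ℤ)) :
    twoΔ A U WΔ hWΔ 2 x = ((2 : k) * 2) • refΔ₁ A U WΔ hWΔ 2 x := by
  obtain ⟨t, rfl⟩ := cup_one_one_surjective_of_covers A U hcov W₀ hW₀ W hW j₀ hj₀ x
  induction t using TensorProduct.induction_on with
  | zero => rw [map_zero, map_zero, map_zero, smul_zero]
  | tmul a b =>
    rw [TensorProduct.lift.tmul, twoΔ_mul A U hcov WΔ hWΔ, refΔ₁_mul A U hcov WΔ hWΔ,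
      twoΔ_degree_one A U hcov W₀ hW₀ W hW j₀ hj₀ WΔ hWΔ, twoΔ_degree_one A U hcov W₀ hW₀ W hW j₀ hj₀ WΔ hWΔ,
      LinearMap.map_smul₂, map_smul, smul_smul]
  | add s t hs ht => rw [map_add, map_add, map_add, hs, ht, smul_add]

end MulTwo

/-! ### The heads with only the diagonal cover as a binder -/

section MulTwoHeads

variable {k : Type} [Field k] [CharZero k] (A : AbelianSchemeOver (Spec (.of k)))
  {ι : Type} [LinearOrder ι] [Fintype ι] (U : ι → A.X.left.affineOpens) (hcov : ⨆ i, (U i).1 = ⊤)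
  (WΔ : (ι ×ₗ ι) ×ₗ ι → A.X.left.affineOpens)
  (hWΔ : ∀ i j l, (WΔ (toLex (toLex (i, j), l))).1 = (U i).1 ⊓ (U j).1 ⊓ mulTwo A ⁻¹ᵁ (U l).1)

omit [CharZero k] in
include hcov in
/-- **`[2]^* = 2` on `Ȟ¹(U, 𝒪_A)`**: for an abelian variety `A` over a field of characteristic `0`, a finite affine open cover
`U` and the diagonal cover `WΔ ((i,j),l) = U_i ∩ U_j ∩ [2]⁻¹U_l`, the pull-back along `[2] = A.mulN 2` (index map
`((i,j),l) ↦ l`) and the refinement (index map `((i,j),l) ↦ i`) satisfy `[2]^* a = 2 • ref a` in `Ȟ¹(WΔ, 𝒪_A)`.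
[cite: MumfordAV1970, §13 Cor. 2] -/
theorem homologyMap_mulTwo_degree_one (a : (CA A U).homology ((1 : ℕ) : ℤ)) :
    twoΔ A U WΔ hWΔ 1 a = (2 : k) • refΔ₁ A U WΔ hWΔ 1 a := by
  obtain ⟨W₀, hW₀, W, hW, j₀, hj₀⟩ := exists_covers A U hcov
  exact twoΔ_degree_one A U hcov W₀ hW₀ W hW j₀ hj₀ WΔ hWΔ a

include hcov in
/-- **`[2]^* = 4` on `Ȟ²(U, 𝒪_A)`**: same setting, `[2]^* x = (2 * 2) • ref x` in `Ȟ²(WΔ, 𝒪_A)`. [cite: MumfordAV1970, §13 Cor. 2] -/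
theorem homologyMap_mulTwo_degree_two (x : (CA A U).homology ((2 : ℕ) : ℤ)) :
    twoΔ A U WΔ hWΔ 2 x = ((2 : k) * 2) • refΔ₁ A U WΔ hWΔ 2 x := by
  obtain ⟨W₀, hW₀, W, hW, j₀, hj₀⟩ := exists_covers A U hcov
  exact twoΔ_degree_two_of_covers A U hcov W₀ hW₀ W hW j₀ hj₀ WΔ hWΔ x

end MulTwoHeads

end Literature.AlgebraicGeometry.AbelianSchemes.AbelianVarietyCech

end
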